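import Summits.Schanuel.Schanuel.Theorems.SoloInformedRoyLiouvillePoints

/-!
# The hypothesis of Roy's Conjecture 2 is void at tuples with an algebraic axis

Roy's Conjecture 2 (rank `l`, `RoyCriterion l`; equivalent to Schanuel's conjecture for rank `l`,
`Roy2001_iff_holds`) asks, from a sequence `P_N` small on the box of the subgroup
`ℤ(y₁,α₁) + ⋯ + ℤ(y_l,α_l) ⊂ 𝔾ₐ × 𝔾ₘ`, for `tr.deg ℚ(y, α) ≥ l`.  Restricted to the `j`-th axis
the hypothesis is condition (b) of Roy's Theorem 1 for `(y_j, α_j)`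
(`royConditionB_of_royHypothesis`, tree), and by `not_royConditionB_of_numberField_admissible`
(Philippon's zero estimate + Liouville's inequality, file `SoloInformedRoyLiouvillePoints`)
condition (b) fails at every point
`(σ y₀, σ α₀)`, `y₀, α₀` in a number field `K`, `σ y₀ ≠ 0`, `σ α₀ ≠ 0`, for every admissible
parameter set.  Hence:

* `not_royHypothesis_of_algebraic_axis`: if ONE axis pair `(y_j, α_j)` consists of algebraic
  numbers (`y_j ≠ 0`, `α_j ≠ 0`), the hypothesis of Conjecture 2 fails for every admissible
  `(s₀, s₁, t₀, t₁, u)` (`not_royHypothesis_of_axis_ratCast`: e.g. an axis `(1, 2)`);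
* `royCriterion_conclusion_of_algebraic_axis`: so the implication asked for by Conjecture 2 holds
  vacuously at such tuples — whatever the other axes are.

Atlas reading (solo seat `solo-Schanuel-informed`, §3 S2 (s5)): the content of Conjecture 2 is
carried entirely by tuples none of whose axes is an algebraic pair; at algebraic axes the
Waldschmidt construction threshold `u > max{1, s₀, t₀, s₁+t₁}` of Roy's Proposition 2 and the
Liouville obstruction coincide.  No step toward Schanuel's conjecture is claimed.
-/

open MvPolynomial Filter Complex
open Literature.NumberTheory.Transcendental

namespace Summit.Schanuel.Schanuel.Theorems

/-- If the `j`-th axis pair `(y_j, α_j)` lies in the image of a number field (`y_j ≠ 0`,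
`α_j ≠ 0`), the hypothesis of Roy's Conjecture 2 fails for every admissible parameter set.
[cite: Roy2001, Conjecture 2, §5 (1°); BakerTNT1975, Ch. 1 Thm. 1.2] -/
theorem not_royHypothesis_of_algebraic_axis {l : ℕ} {y α : Fin l → ℂ} {s₀ s₁ t₀ t₁ u : ℝ}
    (hadm : RoyAdmissible s₀ s₁ t₀ t₁ u) {K : Type*} [Field K] [NumberField K] (σ : K →+* ℂ)
    (j : Fin l) (y₀ α₀ : K) (hyj : σ y₀ = y j) (hαj : σ α₀ = α j) (hy : y j ≠ 0)
    (hα : α j ≠ 0) : ¬ RoyHypothesis y α s₀ s₁ t₀ t₁ u := by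
  intro h
  have hb : RoyConditionB (σ y₀) (σ α₀) s₀ s₁ t₀ t₁ u := by
    rw [hyj, hαj]; exact royConditionB_of_royHypothesis h j
  exact not_royConditionB_of_numberField_admissible σ y₀ α₀ (by rwa [hyj]) (by rwa [hαj]) hadm hb

/-- **Conjecture 2 is vacuously true at tuples with an algebraic axis**: the implication
"hypothesis ⇒ `tr.deg ℚ(y, α) ≥ l`" of `RoyCriterion l` holds at every tuple whose `j`-th axis
pair is algebraic (`y_j ≠ 0`, `α_j ≠ 0`), because the hypothesis fails there (Philippon +
Liouville) — whatever the remaining axes are. [cite: Roy2001, Conjecture 2] -/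
theorem royCriterion_conclusion_of_algebraic_axis {l : ℕ} (y α : Fin l → ℂ)
    {K : Type*} [Field K] [NumberField K] (σ : K →+* ℂ) (j : Fin l) (y₀ α₀ : K)
    (hyj : σ y₀ = y j) (hαj : σ α₀ = α j) (hy : y j ≠ 0) (hα : α j ≠ 0)
    (s₀ s₁ t₀ t₁ u : ℝ) (hadm : RoyAdmissible s₀ s₁ t₀ t₁ u)
    (hhyp : RoyHypothesis y α s₀ s₁ t₀ t₁ u) :
    (l : Cardinal) ≤ Algebra.trdeg ℚ ↥(IntermediateField.adjoin ℚ (Set.range y ∪ Set.range α)) :=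
  (not_royHypothesis_of_algebraic_axis hadm σ j y₀ α₀ hyj hαj hy hα hhyp).elim

/-- Example: any tuple whose first axis is `(y₁, α₁) = (1, 2)` (or any pair of non-zero rationals)
has an algebraic axis, so Roy's hypothesis fails there for all admissible parameters.
[cite: Roy2001, Conjecture 2] -/
theorem not_royHypothesis_of_axis_ratCast {l : ℕ} {y α : Fin l → ℂ} (j : Fin l) (p q : ℚ)
    (hp : p ≠ 0) (hq : q ≠ 0) (hyj : y j = p) (hαj : α j = q) {s₀ s₁ t₀ t₁ u : ℝ}
    (hadm : RoyAdmissible s₀ s₁ t₀ t₁ u) : ¬ RoyHypothesis y α s₀ s₁ t₀ t₁ u := by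
  refine not_royHypothesis_of_algebraic_axis hadm (Rat.castHom ℂ) j p q ?_ ?_ ?_ ?_
  · simp [hyj]
  · simp [hαj]
  · rw [hyj]; exact_mod_cast hp
  · rw [hαj]; exact_mod_cast hq

end Summit.Schanuel.Schanuel.Theorems
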